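import Summits.HodgeConjecture.HodgeConjecture.Theses.PadicSemiregularLift
import Summits.HodgeConjecture.HodgeConjecture.Theorems.HodgeFermatVarieties.Negative.DegreeZeroVacuous
import Literature.AlgebraicGeometry.HodgeTheory.FermatHodgeConjectureAokiProofs
import Literature.AlgebraicGeometry.HodgeTheory.FermatClaimShiodaSpine

/-!
# Line `cancel-by-any-claim-lattice` — skeleton for crux `HodgeFermatVarieties` (stmt-HodgeConjecture-1334)

Route `PadicSemiregularLift`, crux `HodgeFermatVarieties` (rank-5 OUTPUT item):

    ∀ (n m : ℕ) (X : SchemeOver ℂ), IsFermatVariety n m X → IsSmoothProjective n X → HodgeConjectureFor n X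

— the Hodge conjecture for every complex Fermat hypersurface `Xⁿₘ : Σ xᵢᵐ = 0 ⊂ ℙⁿ⁺¹`.

Skeleton generation 2 (planner `cruxplan-…-cancel-by-any-claim--g2`, 2026-08-16; supersedes the gen-1
registration `943215b9…` of the same line: same lever, same vocabulary, same kernel-checked level-66
certificate; the supply stub is re-cut — Shioda's type-II supply of semi-decomposable sextuples is now
its own stub `stub_semiDecomposableClaim`, and `stub_printedSupply` takes the level-change statement as an
antecedent for the IMPRIMITIVE standard elements instead of re-proving it — and the Transfer
"saturated degree ⟹ HC for every `Xⁿₘ`" is a sorry-free theorem `hodgeConjectureFor_of_saturated`).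

Idea `cancel-by-any-claim-lattice` (Cruxes/HodgeFermatVarieties/Ideas/cancel-by-any-claim-lattice.md;
triage r1-1/r1-2/r1-3: pass ×3, merge-partner `sign-class-saturation`). LEVER: reachability of a
Hodge character by the printed supply of algebraic characters is GROUP membership, not semigroup
membership — Aoki 1987 Thm 1-4 (i) (juxtaposition) + (ii) (pair cancellation) give, by the
rewriting `−[g] = [−g] − [g ∗ (−g)]` (`g ∗ (−g)` is paired), the LATTICE CRITERION

    s + ΣN = ΣP (as multisets; P, N drawn from claimed Hodge multisets closed under negation)
      ⟹ claim(s)                                                      (`stub_latticeCriterion`)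

so that, for one degree `m`, HC(`Xⁿₘ`, all `n`) ⟸ "every Hodge multiset of `ℤ/m` is ℤ-reachable
from the printed supply" — pairs (Thm 1-1), Hodge 4-multisets (Fermat surface, Aoki–Shioda 1983
(2.1)), semi-decomposable sextuples (`X¹ₘ × X¹ₘ`, type II), Aoki's standard elements `σ_{p,a}`
(Thm 2-1 + pull-back) — and reachability is STABLE UNDER LEVEL RAISING `[x] ↦ [xᵏ]`
(`claim_m(s) ⟺ claim_{km}(k•s)`, `stub_levelChange`), which is how the one non-reachable class of
degree `33` (da Silva's `(1,4,16,22,25,31)`-orbit; `[L^ev₃₃ : K₃₃] = 2`) dies at level `66`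
(certificate re-verified by all three triagers and by the disprover, cycle 2): HC for ALL `Xⁿ₃₃`,
`Xⁿ₉₉` follows from stubs S0–S3 + S5 alone. Census (ideators 1, 3; triage; disprover): the residual
quotient `L^ev_m /(stable reach)` is `0` for 40 of 71 tested degrees `m ≤ 210` (every degree with HC
in print, plus `33, 39, 66, 78, 99, 117`) and ONE `ℤ/2` sign class otherwise (first: `35`, `44`, `51`,
`52`, `55`, `57`; fourfold classes only at `70, 110, 114, 140` for `m ≤ 160`); the disprover's DEATH
TABLE (Disproof.lean, cycle 2) shows the classes of `35`, `44`, `110` survive level raising at every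
tested multiple (`35k ≤ 490`, `44k ≤ 484`, `110k ≤ 440`).

The skeleton is a REDUCTION + ENGINE line, seven registered stubs:

* `stub_printedFacts` (S0) — the vendored named facts the line consumes (Aoki 1987 Thm 1-4 (i),(ii),
  Thm 1-1, Thm 2-1; Aoki–Shioda 1983 (2.1); existence of Hodge models). Research risk nil.
* `stub_latticeCriterion` (S1, THE LEVER, size M) — ℤ-reachability from a negation-claimed family of
  claimed Hodge multisets implies claim; from Thm 1-4 (i),(ii) only.
* `stub_levelChange` (S2, size L) — `[xᵢ] ↦ [xᵢᵏ] : Xⁿ_{km} → Xⁿₘ`: level raising preserves Hodge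
  multisets and `claim_m(s) ⟺ claim_{km}(k•s)` (`π^*` / `π_*π^* = deg π`). Its `→` half is the
  hypothesis `hDeg` of `FermatHodgeConjectureAokiProofs` up to the multiset/divisor spelling.
* `stub_semiDecomposableClaim` (S3a, size L) — Shioda's TYPE-II SUPPLY: every semi-decomposable Hodge
  sextuple `{x,y,−x−y} + {u,v,−u−v}` is claimed (Lefschetz (1,1) on `X¹ₘ × X¹ₘ` + the ruled join
  `X¹ₘ ∗ X¹ₘ ⇢ X⁴ₘ`). Verbatim the open input `hsemi` of the tree's Shioda spine
  (`isShiodaClosed_claimMultiset`, `claim_of_shiodaCondition`), for every level: closing it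
  discharges `hsemi` tree-wide.
* `stub_printedSupply` (S3b, size M) — granted the three facts of S0, S3a and S2: every element of the
  printed supply, and its negation, is a claimed non-empty Hodge multiset (pairs/surface/standard from
  the facts; imprimitive standard elements `σ_{p,a}`, `(⟨a⟩,d) = g > 1`, as `g •` the primitive
  `σ_{p,a/g}` of level `M/g`, raised by S2). Arithmetic only.
* `stub_residualSignClasses` (S4, THE ENGINE, open — hardest) — a Hodge multiset NOT stably
  reachable is claimed. Vacuous at every saturated degree; modulo the other stubs it is the crux
  restricted to the Yamamoto–Aoki sign classes (one `ℤ/2`-coset per bad degree in every computed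
  case), and by S1 it suffices to make ONE class per coset algebraic (host route: p-adic seeds P2R
  at Fermat anchors; cards odd-coniveau-calculus, cyclotomic-weil-rank). First instances:
  `V(gap₃₅) ⊂ H⁶(X⁶₃₅)`, `V(gap₄₄) ⊂ H⁶(X⁶₄₄)`, `V(s₀) ⊂ H⁴(X⁴₁₁₀)`, the `X⁴₁₁₄` sextuples.
* `stub_eigenspaceStructure` (S5, size L) — Ran 1980 Prop. 1.7 on the real carriers: the hypothesis
  `hE` of `hodgeClasses_algebraic_fermat_of_claims_at'` for every `m ≥ 1`, `p > 0`.

PROVED HERE (no `sorry`): the LEVEL-66 CERTIFICATE of the card — `identity_sixtySix` (the 182-element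
multiset identity `2•(7,10,13,19,22,28) + ΣNEG = ΣPOS` over `ℤ/66`, by `decide +kernel`),
`certShape_of_mem_POS/NEG` (all 115 generators are pairs, Hodge 4-multisets — Hodge-ness decided over
the 20 units — or the `11`-standard `σ_{11,1}`, `σ_{11,2}`), hence `reach_sixtySix_daSilvaDouble`,
`stableReach_daSilvaGap : StableReach[33, (7,10,13,19,22,28)]`, the engine-free corollary
`claimMultiset_daSilvaGap_of_stubs : S0-facts → S1 → S2 → S3a → S3b → ClaimMultiset 33 {7,10,13,19,22,28}`
(da Silva's class, the first character open in print, needs only the research-risk-nil stubs), and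
the TRANSFER `hodgeConjectureFor_of_saturated : S0-facts → S1 → S2 → S3a → S3b → S5 →
(every non-empty Hodge multiset of level m is stably reachable) → HC for every smooth projective
Fermat `Xⁿₘ`. (Kernel time ≈ 6 s.)

`HodgeFermatVarieties_of` (no `sorry` of its own) composes the stubs BY NAME through the sorry-free
`lineImplication : S0 → S1 → S2 → S3a → S3b → S4 → S5 → HodgeFermatVarieties`: `m = 0` is vacuous
(the LANDED Negative lemma `Theorems.HodgeFermatVarietiesNegative.degree_zero_vacuous`, imported);
for `m ≥ 1` the Hodge-model conjunct is S0's `nonempty_hodgeModel`, the cycle part is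
`hodgeClasses_algebraic_fermat_of_claims_at'` fed S5 and `hB`; `hB` (claim for every Hodge character
`α` of every `X²ᵖₘ`) is obtained on the value multiset `s` of `α`: if `s` is stably reachable, S2
makes `k•s` Hodge, S3b (fed S3a, S2) makes the supply of level `km` a claimed negation-claimed
family, S1 gives `claim_{km}(k•s)` and S2 descends to `claim_m(s)`; otherwise S4.

Disproof used (Cruxes/HodgeFermatVarieties/Disproof.lean, cdisprove cycles 1–2, read 2026-08-16):
§2 — NO `_false_without_` theorem exists (neither hypothesis is load-bearing; nothing to honour
beyond HC itself); §3 `degree_zero_vacuous` — LANDED as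
`Theorems/HodgeFermatVarieties/Negative/DegreeZeroVacuous.lean` (p70499), imported here and used for
the `m = 0` branch of `_of`; the other landed lemmas of that file (`iff_galoisSieve_fermatHC`,
`iff_supersingularIsotypicLift_fermatHodge`, `fermatFourfoldThirtyThree_of`, `of_hodgeConjecture`)
are equivalences/consequences, not refutations, so no stub is an instance of a refuted statement;
§4 `iff_standardModel_of` — the line works on the standard model `fermatHypersurface` throughout
(`FermatCharacter.Claim`); §6 `not_forall_shiodaCondition*` — honoured: no stub asserts a uniform
`(Pₘ)`; §7 (cycle 2) `exists_levelCalculusClosed_not_daSilva33` — the printed claim calculus OF ONE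
LEVEL (pairs, surface, semi, (i), (ii), type I, `σ_{3,a}`, `σ_{11,a}`, and even the card's GC) cannot
reach da Silva's class at level `33`: HONOURED BY CONSTRUCTION — the line changes level
(`stableReach_daSilvaGap` uses `k = 2`; `StableReach` quantifies over all multiples), and the same
file re-verifies the level-66 certificate a fourth time; cycle-2 DEATH TABLE — the sign classes of
`35` (`X⁶₃₅`), `44` (`X⁶₄₄`), `110` (`X⁴₁₁₀`) survive at every tested multiple: recorded in S4 as
its first non-vacuous instances (no stub claims they are reachable). Negatives index:
`DerivedTorelliFermatK3Exhaustion_refuted` (m = 110 witness `{1,24,62,71,81,91}`) — that sextuple is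
NOT asserted reachable; it is exactly the degree-110 residual class, an instance of S4's hypothesis.
The only landed Negative file is the vacuity/equivalence file above (imported); `-- Targets`: none yet.
-/

set_option linter.dupNamespace false

noncomputable section

open CategoryTheory AlgebraicGeometry Finset
open Literature.AlgebraicGeometry Literature.AlgebraicGeometry.Motives
open Literature.AlgebraicGeometry.HodgeTheory Literature.AlgebraicGeometry.HodgeTheory.FermatCharacter
open Literature.AlgebraicTopology.SingularHomology

namespace Summit.HodgeConjecture.HodgeConjecture.Cruxes.HodgeFermatVarieties.CancelByAnyClaimLattice

/-! ### Vocabulary of the line — LOCAL NOTATIONS only (they expand to terms over the tree's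
`IsHodgeMultiset` / `IsSemiDecomposable` / `ClaimMultiset`, so every registered stub signature is a
closed statement over existing, importable declarations; a stub worker copies these four
`local notation3` lines verbatim) -/

/-- `Supply[M]` — **the printed supply of level `M`** (`: Set (Multiset (ZMod M))`): the multisets of
residues mod `M` whose claim is in print — pairs `{a, -a}` (linear subspaces, Aoki Thm 1-1), Hodge
multisets with `4` elements (Fermat surface, Aoki–Shioda 1983 (2.1) / Lefschetz (1,1)),
semi-decomposable Hodge sextuples (`X¹ₘ × X¹ₘ`, Shioda's type II of two curve characters), and Aoki's
standard elements `σ_{p,a} = {a, a+d, …, a+(p-1)d} + {-pa}`, `p` an odd prime dividing `M`,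
`d = M/p`, under Aoki's side condition `d/(⟨a⟩, d) > 2` (primitive ones, `(⟨a⟩, d) = 1`: Thm 2-1;
imprimitive ones: pull-back from level `M/(⟨a⟩,d)`). This is the generating set `K_M` of the idea
card's census (ideator 1 CENSUS.md; crux NOTES.md `L_D(m)`). Local notation only. -/
local notation3 (prettyPrint := false) "Supply[" M "]" =>
  ({s : Multiset (ZMod M) | ∃ a : ZMod M, a ≠ 0 ∧ s = ({a, -a} : Multiset (ZMod M))} ∪
    {s : Multiset (ZMod M) | IsHodgeMultiset s ∧ Multiset.card s = 4} ∪
    {s : Multiset (ZMod M) | IsHodgeMultiset s ∧ IsSemiDecomposable s} ∪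
    {s : Multiset (ZMod M) | ∃ (p : ℕ) (a : ZMod M), p.Prime ∧ p ≠ 2 ∧ p ∣ M ∧
        2 < (M / p) / Nat.gcd (ZMod.val a) (M / p) ∧
        s = Multiset.map (fun j : ℕ => a + (j : ZMod M) * ((M / p : ℕ) : ZMod M)) (Multiset.range p) +
              {-((p : ZMod M) * a)}} : Set (Multiset (ZMod M)))

/-- `Reach[M, s]` — **ℤ-reachability** of the multiset `s` of level `M` from the printed supply:
`s + ΣN = ΣP` as multisets for finite families `P`, `N` of supply elements — i.e. the multiplicity
vector of `s` lies in the ℤ-span of those of `Supply[M]` (`P` the positive, `N` the negative part).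
Shioda's `(Pₘ)` / Aoki's reachability is the special case in which `N` consists of pairs only.
Local notation only. -/
local notation3 (prettyPrint := false) "Reach[" M ", " s "]" =>
  ∃ P N : Multiset (Multiset (ZMod M)),
    (∀ u ∈ P, u ∈ Supply[M]) ∧ (∀ u ∈ N, u ∈ Supply[M]) ∧ s + Multiset.sum N = Multiset.sum P

/-- `LevelRaise[k, m, s]` — **level raising** `s ↦ k • s` (`: Multiset (ZMod (k * m))` for
`s : Multiset (ZMod m)`): the pull-back of characters along `[xᵢ] ↦ [xᵢᵏ] : Xⁿ_{km} → Xⁿₘ`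
(`π^* V_m(α) = V_{km}(kα)`; representatives multiply by `k`). Local notation only. -/
local notation3 (prettyPrint := false) "LevelRaise[" k ", " m ", " s "]" =>
  Multiset.map (fun a : ZMod m => ((k * ZMod.val a : ℕ) : ZMod (k * m))) s

/-- `StableReach[m, s]` — **stable reachability**: `s` becomes ℤ-reachable from the printed supply
after raising the level by some `k ≥ 1` (`k = 1`: reachable at its own level; `k = 2` kills
da Silva's degree-`33` class at level `66`). Local notation only. -/
local notation3 (prettyPrint := false) "StableReach[" m ", " s "]" =>
  ∃ k : ℕ, 0 < k ∧ Reach[k * m, LevelRaise[k, m, s]]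

/-! ### Sanity: the vocabulary computes on the decisive instances -/

/-- da Silva's non-quasi-decomposable class of `X⁴₃₃` (unit-orbit representative used by the
census) IS a Hodge multiset. [cite: daSilva2021HodgeFermat, Prop. 3.6 (version of record Prop. 3.4)] -/
example : IsHodgeMultiset ({7, 10, 13, 19, 22, 28} : Multiset (ZMod 33)) := by
  unfold IsHodgeMultiset mNormSum; decide

/-- … and its level-`66` pull-back is `(14, 20, 26, 38, 44, 56)`. [folklore] -/
example : LevelRaise[2, 33, ({7, 10, 13, 19, 22, 28} : Multiset (ZMod 33))] =
    ({14, 20, 26, 38, 44, 56} : Multiset (ZMod (2 * 33))) := by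
  decide

/-- A pair is in the printed supply (here `{4, 62}` at level `66`, one of the certificate's `NEG`). [folklore] -/
example : ({4, 62} : Multiset (ZMod 66)) ∈ Supply[66] :=
  Or.inl (Or.inl (Or.inl ⟨4, by decide, by decide⟩))

/-- A semi-decomposable Hodge sextuple is in the printed supply (here `{1,2,30} + {12,23,31}` at level
`33`: `1+2+30 = 33`, `12+23+31 = 66`; not paired). [folklore] -/
example : ({1, 2, 30, 12, 23, 31} : Multiset (ZMod 33)) ∈ Supply[33] :=
  Or.inl (Or.inr ⟨by unfold IsHodgeMultiset mNormSum; decide,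
    ⟨{1, 2, 30}, {12, 23, 31}, rfl, rfl, by decide, by decide, by decide⟩⟩)

/-! ### The registered stubs -/

/-- **S0 `stub_printedFacts` — the vendored package the line consumes** (NAMED FACTS of
`Literature/AlgebraicGeometry/HodgeTheory`, each closing when discharged in Literature; research risk
nil): Aoki 1987 Thm 1-4 (i) juxtaposition, Thm 1-4 (ii) pair cancellation, Thm 1-1 linear subspaces
(Shioda/Ran), Thm 2-1 `p`-standard subvarieties; Aoki–Shioda 1983 (2.1) (every Hodge eigenline of the
Fermat surface is algebraic = Lefschetz (1,1) + Shioda Thm I); existence of Hodge models of smooth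
projective varieties (GAGA + Hodge decomposition). Proof files in progress in the tree:
`FermatJuxtapositionGysin`, `FermatClaimPairedCancellation`, `ShiodaClaimPairedProofs`,
`FermatInductiveClaimsProofs`, `HodgeModelExistence`. -/
theorem stub_printedFacts :
    Aoki1987_claim_juxtaposition ∧ Aoki1987_claim_of_claim_juxtaposition_paired ∧
      Shioda_claim_paired ∧ Aoki1987_claim_pStandard ∧ AokiShioda1983_eigenline_le_neronSeveri ∧
      ∀ (n : ℕ) (X : SchemeOver ℂ), nonempty_hodgeModel n X := by
  sorry

/-- **S1 `stub_latticeCriterion` — THE LEVER: ℤ-reachability from claimed characters implies claim**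
(general cancellation in lattice form; size M, research risk nil — re-derived by triage r1-2/r1-3).
Granted Aoki 1987 Thm 1-4 (i) and (ii): let `D` be any family of non-empty Hodge multisets of level
`M` each of which, together with its negation, is claimed. If `s ≠ 0` is a Hodge multiset with
`s + ΣN = ΣP` for finite families `P, N ⊆ D`, then `claim(s)`. Proof: put
`δ := Σ_{u ∈ N} (u + (−u))` — a juxtaposition of pairs with non-zero entries (`IsPaired`); then
`s + δ = ΣP + Σ_{u∈N}(−u)` as multisets; the right side is a juxtaposition of claimed non-empty Hodge
multisets, hence claimed by iterating (i) (`ClaimMultiset.star_of_juxtaposition`); so `claim(s ∗ δ)`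
and (ii) cancels `δ` (realise `s`, `δ` as characters: `IsHodgeMultiset.exists_isHodge_even`,
`FermatCharacter.pairs`/`isPaired_pairs`). `N = ∅` is plain iteration of (i); `P = ∅` forces `s = 0`.
Special case `D ∋ τ, −τ` Hodge claimed: `claim(α ∗ τ) ⟹ claim(α)` ("cancel by ANY claimed character",
the card's GC — no Ran transpose needed, triage r1-1/r1-3). -/
theorem stub_latticeCriterion :
    Aoki1987_claim_juxtaposition → Aoki1987_claim_of_claim_juxtaposition_paired →
    ∀ (M : ℕ) [NeZero M] (D : Set (Multiset (ZMod M))),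
      (∀ u ∈ D, u ≠ 0 ∧ IsHodgeMultiset u ∧ ClaimMultiset M u ∧
        ClaimMultiset M (u.map fun a ↦ -a)) →
      ∀ (s : Multiset (ZMod M)) (P N : Multiset (Multiset (ZMod M))),
        s ≠ 0 → IsHodgeMultiset s → (∀ u ∈ P, u ∈ D) → (∀ u ∈ N, u ∈ D) → s + N.sum = P.sum →
        ClaimMultiset M s := by
  sorry

/-- **S2 `stub_levelChange` — functoriality of claim along `[xᵢ] ↦ [xᵢᵏ]`** (size L, research risk
nil; Shioda–Katsura 1979 §1, implicit in Aoki 1987 Cor. 2-3 and da Silva Thm 2.8). For `k ≥ 1` the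
finite flat `μ`-equivariant morphism `π : Xⁿ_{km} → Xⁿₘ`, `[xᵢ] ↦ [xᵢᵏ]`, of degree `kⁿ⁺¹` has
`π^* V_m(α) ⊆ V_{km}(kα)` (`π ∘ T_ζ = T_{ζᵏ} ∘ π`) and `π_* π^* = deg π`; flat pull-back and finite
push-forward preserve algebraic classes. Hence for a non-empty Hodge multiset `s` of level `m`:
(a) `k • s` is a Hodge multiset of level `km` (arithmetic: `⟨T·(ka)⟩_{km} = k⟨t̄a⟩_m` for a unit `T`
of `ℤ/km` with image `t̄` in `(ℤ/m)ˣ`, `ZMod.unitsMap`), and (b) `claim_m(s) ⟺ claim_{km}(k•s)` —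
`→` by `π^*` (the input `hDeg` of `FermatHodgeConjectureAokiProofs` in multiset/multiple spelling:
realise `s` by a character `α'`, `IsHodgeMultiset.exists_isHodge_even`, put `α := k • α'`,
`claimMultiset_univ_val_map_iff` both ways), `←` by `π_*` (`V_m(α') = π_*π^*V_m(α') ⊆ π_*V_{km}(α)`).
DIMENSION-FREE form of `→` (the input `dim V(α) = 1` is NOT in the tree, see the header of
`FermatDiagonalAction`): `X_m = X_{km}/K` for `K = μₖⁿ⁺² = ker(μ_{km}ⁿ⁺² → μₘⁿ⁺²)`, the character
`k • α'` is trivial on `K`, so `V_{km}(kα') ⊆ H(X_{km})^K = π^* H(X_m) = ⊕_β π^* V_m(β)` with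
`π^* V_m(β) ⊆ V_{km}(kβ)` and `β ↦ kβ` injective; hence `V_{km}(kα') = π^* V_m(α') ⊆ π^*(Alg) ⊆ Alg`.
On the tree's carriers this needs the morphism `fermatHypersurface n (k*m) ⟶ fermatHypersurface n m`
(`[xᵢ] ↦ [xᵢᵏ]`, a quotient by `K`), its intertwining with `fermatEigenspace`, flat pull-back
`map_mem_algebraicClasses_of_flat`, and the finite push-forward / transfer `π_*` with
`π_* π^* = kⁿ⁺¹` and `π_*(Alg) ⊆ Alg` (patterns: `complexGysin_map_mem_algebraicClasses_of_flat` of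
`FermatJuxtapositionGysin`; `Motives.CorrespondencesCompProofs.pushforward`). -/
theorem stub_levelChange :
    ∀ (m k : ℕ) [NeZero m], 0 < k → ∀ s : Multiset (ZMod m), s ≠ 0 → IsHodgeMultiset s →
      IsHodgeMultiset (LevelRaise[k, m, s]) ∧ (ClaimMultiset m s ↔ ClaimMultiset (k * m) (LevelRaise[k, m, s])) := by
  sorry

/-- **S3a `stub_semiDecomposableClaim` — Shioda's type-II supply: semi-decomposable Hodge sextuples are
claimed** (size L, research risk nil; NOT a named fact of the tree — verbatim the open input `hsemi`
of `isShiodaClosed_claimMultiset` / `claim_of_shiodaCondition` (`FermatClaimShiodaSpine`), for every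
level, so closing it discharges that input tree-wide). A Hodge multiset `s = t + u` of level `M` with
`t = {x,y,z}`, `u = {x',y',z'}` each summing to `0` (all entries non-zero as `s` is Hodge): `t`, `u`
are admissible characters of the Fermat CURVE `X¹_M`, and the Hodge condition on `s` says
`{|wt|, |wu|} = {1, 2}` for every unit `w`, i.e. `⊕_w V(wt) ⊗ V(wu) ⊂ H²(X¹_M × X¹_M; ℚ) ⊗ ℂ` is a
rational sub-Hodge structure of type `(1,1)`, hence spanned by divisor classes (Lefschetz (1,1) on
the smooth projective surface `X¹_M × X¹_M`; tree: `lefschetzOneOne_rational`); the ruled join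
`X¹_M ∗ X¹_M ⇢ X⁴_M` (the `ℙ¹`-bundle of lines joining the two curves inside `X⁴_M`, Shioda 1979
Math. Ann. 245 Thm I–II / PJA §1 Def. (iii), Ran 1980 §4 `∗ = p₂₊p₁^*`, Prop. 4.6–Cor. 4.7) is an
algebraic correspondence (`ℙ¹`-bundle `Z → X¹_M × X¹_M`, `Z → X⁴_M`, codimension-`3` cycle on the
product; acts `H²(X¹×X¹) → H⁴(X⁴)`) carrying `V(t) ⊗ V(u)` ONTO the eigenspace `V(α)` for the
character `α = (x,y,z,x',y',z')` (one arrangement suffices: `Claim.of_univ_val_map_eq`), and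
algebraic classes to algebraic classes: claim(α). SURJECTIVITY onto `V(α)` WITHOUT `dim V(α) = 1`
(not in the tree): in Shioda's decomposition `H⁴_prim(X⁴) = I ⊕ II` (Math. Ann. 245 Thm I, `r = s = 2`)
the type-I summand only meets characters whose first three entries do NOT sum to `0` (`e = −(x+y+z)`
must be non-zero), so `V(α) ⊆ II = Z_*(H¹ ⊗ H¹)` and equivariance gives `V(α) = Z_*(V(t) ⊗ V(u))`.
This is Shioda 1979 PJA §1 Def. (iii) + the proof of his Thm 1 ("semi-decomposable ⟹ `ξ ∈ 𝔠ₘ` via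
`X¹ₘ × X¹ₘ`"): a PRINTED theorem; should it be vendored as a named fact, this stub becomes a
conjunct of S0 (lead's reshape). Carrier pattern: `complexGysin_map_exterior_mem_algebraicClasses`
(`FermatJuxtapositionGysin`, written for the even-dimensional type II of Thm 1-4 (i)); here the
factors are curves (odd degree `1 + 1 = 2`). -/
theorem stub_semiDecomposableClaim :
    ∀ (M : ℕ) [NeZero M] (s : Multiset (ZMod M)), IsHodgeMultiset s → IsSemiDecomposable s →
      ClaimMultiset M s := by
  sorry

/-- **S3b `stub_printedSupply` — the printed supply consists of claimed characters, closed under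
negation** (size M, research risk nil; ARITHMETIC ONLY given its antecedents). Granted Thm 1-1
(`Shioda_claim_paired`), Aoki–Shioda 1983 (2.1) (`AokiShioda1983_eigenline_le_neronSeveri`), Thm 2-1
(`Aoki1987_claim_pStandard`), the type-II supply (statement of S3a) and level change (statement of
S2): every `u ∈ Supply[M]` is a non-empty Hodge multiset with `claim(u)` and `claim(−u)`. Pairs:
`ClaimMultiset.pair` (dimension `0`, no fact needed); Hodge-ness `mNormSum_pair`. Hodge 4-multisets:
`ClaimMultiset.surface_of_claim_one` fed the Aoki–Shioda fact (which IS `∀ α : Fin (2*1+2) → ZMod M,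
IsHodge α → Claim M 1 α`, `Iff.rfl`). Semi-decomposable Hodge sextuples: the S3a antecedent.
Standard elements `σ_{p,a}`, `d = M/p`, `g := (⟨a⟩, d)`, `d/g > 2` (so every entry is non-zero:
`a + jd ≡ 0 (M)` would force `d ∣ ⟨a⟩`): PRIMITIVE (`g = 1`): Hodge by `isHodge_pStandard`
(`FermatInductiveClaimsProofs`), claimed by Thm 2-1 (`p = 2r+1`, `claimMultiset_univ_val_map_iff`);
IMPRIMITIVE (`g > 1`): write `M = g * M'` (`obtain ⟨M', rfl⟩`), then
`σ_{p,a} = LevelRaise[g, M', σ_{p,a/g}]` as multisets with `(⟨a/g⟩, M'/p) = 1`, `M'/p = d/g > 2`,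
and the S2 antecedent raises Hodge-ness and claim from level `M'` (pattern: `std_descend` of
`FermatHodgeConjectureAokiProofs`, written for `pᵏ`). Negations stay in the supply:
`−{a,−a} = {a,−a}`, `−`(Hodge 4-set) is a Hodge 4-set, `−`(semi) is semi (`IsHodgeMultiset.neg`-type
bookkeeping), `−σ_{p,a} = σ_{p,−a}` (`−(a + jd) = (−a) + (p−j)d − M`; `(⟨−a⟩, d) = (⟨a⟩, d)` as
`d ∣ M`). -/
theorem stub_printedSupply :
    Shioda_claim_paired → AokiShioda1983_eigenline_le_neronSeveri → Aoki1987_claim_pStandard →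
    (∀ (M : ℕ) [NeZero M] (s : Multiset (ZMod M)), IsHodgeMultiset s → IsSemiDecomposable s →
      ClaimMultiset M s) →
    (∀ (m k : ℕ) [NeZero m], 0 < k → ∀ s : Multiset (ZMod m), s ≠ 0 → IsHodgeMultiset s →
      IsHodgeMultiset (LevelRaise[k, m, s]) ∧
        (ClaimMultiset m s ↔ ClaimMultiset (k * m) (LevelRaise[k, m, s]))) →
    ∀ (M : ℕ) [NeZero M], ∀ u ∈ Supply[M],
      u ≠ 0 ∧ IsHodgeMultiset u ∧ ClaimMultiset M u ∧ ClaimMultiset M (u.map fun a ↦ -a) := by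
  sorry

/-- **S4 `stub_residualSignClasses` — THE ENGINE (open; where the crux's research risk lives): the
residual sign classes are algebraic.** For every level `m ≥ 1`, a non-empty Hodge multiset that is
NOT stably reachable from the printed supply is nevertheless claimed. STATUS. Implied by HC (not
refutable short of refuting HC); modulo S0–S3b, S5 equivalent to the crux restricted to the
non-reachable classes. CENSUS (ideator 1 CENSUS.md, crux NOTES.md, triage Appendices, Disproof cycle
2; exact integer HNF/SNF, four independent codes): the hypothesis `¬ StableReach` is EMPTY — so this
stub is vacuous — for `m` = every tested prime power and `2pᵉ` (HC in print there), every `m ≤ 32`,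
and `34, 36, 38, 39, 40, 42, 45, 46, 48, 49, 50, 54, 56, 58, 60, 62, 63, 66, 72, 75, 78, 80, 84, 86,
90, 94, 96, 98, 100` (index 1 already at `k = 1`) and for `33, 99` (`k = 2`: the level-66 certificate
below; `99`'s residual generator is `3 • gap₃₃`); the residual is ONE `ℤ/2`-coset at `35, 44, 51,
52, 55, 57, 65, 68, 69, 70, 76, 77, 85, 87, 88, 91, 92, 93, 95, 102, 105, 110, 114, …` (two at
`165`) unless a higher level kills it. LEVEL RAISING DOES NOT KILL THE NEXT ONES (Disproof.lean cycle
2, DEATH TABLE, exact; each survival is an explicit parity functional vanishing on every printed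
generator of the raised level): `gap₃₅ = {1,2,16,17,21,22,30,31}` (`X⁶₃₅`, `= (2,16,17) ∗
(1,21,22,30,31)`; NO residual sextuple at `35`, so HC(`X⁴₃₅`) is engine-free) survives at every
`35k ≤ 490`; `gap₄₄ = {1,4,5,13,33,37,41,42}` (`X⁶₄₄`) at every `44k ≤ 484`; the K3Exhaustion
witness `s₀ = {1,24,62,71,81,91}` (`X⁴₁₁₀`) at `110k ≤ 440`; `gap₃₃` dies exactly at the EVEN
multiples. Structural reason (gen-1 kit job j009025 + Kubert–Yamamoto): for `(M, 6) = 1` the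
level-`M` supply is pairs + standard only, so `L_M/K_M` is Yamamoto's gap group and a sign class of
level coprime to `6` can only die at levels divisible by `2` or `3`; for `35` the levels `70, 105,
210, 315, 420` do not do it either. So at `m = 35, 44, 110, 114` an ENGINE — a genuinely new algebraic
cycle — is needed; minimal targets, in order: the eigenline `V(gap₃₅) ⊂ H⁶(X⁶₃₅; ℂ)` (same coset as
the fourfold class `{1,20,24,42,61,62}` of `X⁴₇₀`), `V(gap₄₄) ⊂ H⁶(X⁶₄₄)`, `V(s₀) ⊂ H⁴(X⁴₁₁₀)`, the
`X⁴₁₁₄` sextuples; `m = 51, 55`: cardinality `≥ 10`. REDUCTION BUILT IN: by S1 it suffices to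
exhibit, per residual coset, ONE claimed Hodge multiset in it (adjoin it and its negation to `D`).
ENGINES ON FILE for that one class: the host route's p-adic semiregular seeds at the Fermat anchor
`p ≡ −1 (m)` (items P1a `FormalLiftingFromClassLifting` + P2R + P3a `FormalVectorBundlesAlgebraize`
— this stub is exactly where `PadicSemiregularLift` needs seeds, and only for one class per bad
degree); GHC(coniveau 1) for the level-one piece `(1,21,22,30,31) ⊂ H³(X³₃₅)` (line
odd-coniveau-calculus); Weil-family semiregular deformation (cards cyclotomic-weil-rank /
split-weil-semiregular-anchor). WHY IT MIGHT FAIL: a residual class is a Hodge class of CM type with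
no cycle over the classical fields `ℚ(ζ_{2m}, p^{1/d})` (Das 2000, crux NOTES `## Barrier notes`);
nothing cheaper than a new cycle or a new engine decides it; the disprover now attacks exactly these
eigenlines. -/
theorem stub_residualSignClasses :
    ∀ (m : ℕ) [NeZero m] (s : Multiset (ZMod m)), s ≠ 0 → IsHodgeMultiset s →
      ¬ StableReach[m, s] → ClaimMultiset m s := by
  sorry

/-- **S5 `stub_eigenspaceStructure` — Ran 1980 Prop. 1.7 / Shioda 1979 Thm I on the real carriers**
(size L, research risk nil; Griffiths residues or Pham's basis for the affine Fermat hypersurface):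
for every `m ≥ 1` and `p > 0`, on the standard model `X²ᵖₘ = V₊(Σ xᵢᵐ)`: (E2) `V(α) ∩ H²ᵖ = 0` for
`α ≠ 0` with some `αᵢ = 0` (such eigenspaces live in the primitive part, where only admissible
characters occur); (E0) the invariant part `V(0) ∩ H²ᵖ` is restricted from `ℙ²ᵖ⁺¹`
(`H²ᵖ(X)^{μ} = H²ᵖ(X/μ) = H²ᵖ(ℙ²ᵖ) = ℂ (mh)ᵖ`); (E4) a zero-free `β` whose eigenline carries a
non-zero class of type `(p,p)` in some Hodge model has `2|β| = 2p + 2` (`V(β) ⊂ H^{|β|−1, 2p+1−|β|}`;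
for `Σβᵢ ≠ 0` the eigenline is `⊥`, `fermatEigenspace_eq_bot_of_sum_ne_zero`, PROVED). Verbatim the
hypothesis `hE` of `hodgeClasses_algebraic_fermat_of_claims_at'` (and of every sibling assembly in
`FermatHodgeConjectureAssembly` / `…AokiProofs`), quantified over all `m ≥ 1`: closing it discharges
(E) tree-wide. -/
theorem stub_eigenspaceStructure :
    ∀ (m : ℕ) [NeZero m] ⦃p : ℕ⦄, 0 < p →
      (∀ α : Fin (2 * p + 2) → ZMod m, α ≠ 0 → (∃ i, α i = 0) → fermatEigenspace m α (2 * p) = ⊥) ∧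
      (fermatEigenspace m (0 : Fin (2 * p + 2) → ZMod m) (2 * p) ≤
        LinearMap.range (complexBetti.map (SmoothHypersurface.hypersurfaceι (fermatPolynomial ℂ (2 * p) m)) (2 * p)).hom) ∧
      (∀ (A : HodgeModel (2 * p) (fermatHypersurface (2 * p) m)) (β : Fin (2 * p + 2) → ZMod m),
        (∀ i, β i ≠ 0) →
        (∃ x ∈ fermatEigenspace m β (2 * p), x ≠ 0 ∧ A.pullback (2 * p) x ∈ A.hodgePQ (2 * p) p p) →
          2 * FermatCharacter.normSum β = m * (2 * p + 2)) := by
  sorry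

/-! ### Certificate proved here: da Silva's degree-33 class is stably reachable (it dies at level 66) -/

/-- `POS` — the positive part of the level-66 certificate of the idea card (ideator 1,
`IdeatorOneCensus.md`; re-verified independently by all three triagers and the disprover,
`cert66*.py`): 75 supply elements of level `66` — 59 pairs, 12 Hodge 4-multisets (Fermat surface
`X²₆₆`), 4 `3`-standard 4-multisets (also Hodge 4-multisets). [folklore] -/
def POS : Multiset (Multiset (ZMod 66)) :=
  Multiset.replicate 10 {2, 64} + Multiset.replicate 5 {8, 58} + Multiset.replicate 5 {32, 34} +
  Multiset.replicate 5 {33, 33} +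
  Multiset.replicate 3 {6, 60} + Multiset.replicate 3 {10, 56} + Multiset.replicate 3 {14, 52} +
  Multiset.replicate 3 {20, 46} + Multiset.replicate 3 {24, 42} + Multiset.replicate 3 {28, 38} +
  Multiset.replicate 3 {30, 36} +
  Multiset.replicate 2 {11, 55} + Multiset.replicate 2 {17, 49} + Multiset.replicate 2 {31, 35} +
  {{3, 63}, {5, 61}, {9, 57}, {13, 53}, {19, 47}, {23, 43}, {27, 39}} +
  Multiset.replicate 2 {1, 25, 44, 62} + Multiset.replicate 3 {1, 34, 35, 62} +
  Multiset.replicate 7 {1, 37, 44, 50} +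
  {{7, 29, 45, 51}} + Multiset.replicate 3 {4, 26, 48, 54}

/-- `NEG` — the negative part of the level-66 certificate: 40 supply elements of level `66` — 17 Hodge
4-multisets (among them the `2`-adic Davenport–Hasse classes `{1,33,34,64} = σ_{2,1} ∪ {33}`,
`{11,33,44,44}`), 4 pairs, 16 `3`-standard 4-multisets, and the `11`-standard 12-tuples
`σ_{11,2}` (twice; imprimitive, `= 2 • σ_{11,1}` of level `33`) and `σ_{11,1}` (once; Aoki Thm 2-1,
`d = 6 > 2`, `(1,6) = 1`). [folklore] -/
def NEG : Multiset (Multiset (ZMod 66)) :=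
  Multiset.replicate 8 {1, 33, 34, 64} + Multiset.replicate 5 {2, 35, 37, 58} +
  Multiset.replicate 2 {1, 17, 50, 64} + Multiset.replicate 2 {11, 33, 44, 44} +
  Multiset.replicate 3 {4, 62} + {{29, 37}} +
  Multiset.replicate 3 {6, 28, 48, 50} + Multiset.replicate 3 {10, 32, 36, 54} +
  Multiset.replicate 3 {8, 30, 42, 52} + Multiset.replicate 3 {2, 24, 46, 60} +
  {{9, 31, 39, 53}, {5, 27, 49, 51}, {3, 25, 47, 57}, {1, 23, 45, 63}} +
  Multiset.replicate 2 {2, 8, 14, 20, 26, 32, 38, 44, 44, 50, 56, 62} +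
  {{1, 7, 13, 19, 25, 31, 37, 43, 49, 55, 55, 61}}

set_option maxRecDepth 100000 in
/-- **The level-66 identity, kernel-checked**: `2 • (7,10,13,19,22,28) + ΣNEG = ΣPOS` as multisets of
residues mod `66` (182 elements a side). [folklore] -/
theorem identity_sixtySix :
    LevelRaise[2, 33, ({7, 10, 13, 19, 22, 28} : Multiset (ZMod 33))] + NEG.sum = POS.sum := by
  decide +kernel

/-- Hodge multisets of a fixed level are decidable (a finite check over the units). [folklore] -/
local instance decIsHodgeMultiset (s : Multiset (ZMod 66)) : Decidable (IsHodgeMultiset s) := by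
  unfold IsHodgeMultiset mNormSum; infer_instance

/-- `CertShape[u]` — a decidable sufficient condition for membership in `Supply[66]`, covering the
certificate: a pair, a Hodge 4-multiset, or one of the two `11`-standard 12-tuples. Local notation only. -/
local notation3 (prettyPrint := false) "CertShape[" u "]" =>
  ((∃ a : ZMod 66, a ≠ 0 ∧ u = ({a, -a} : Multiset (ZMod 66))) ∨ (IsHodgeMultiset u ∧ Multiset.card u = 4) ∨
    u = ({2, 8, 14, 20, 26, 32, 38, 44, 44, 50, 56, 62} : Multiset (ZMod 66)) ∨
    u = ({1, 7, 13, 19, 25, 31, 37, 43, 49, 55, 55, 61} : Multiset (ZMod 66)))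

/-- `σ_{11,2} = {2, 8, …, 62} + {−22}` of level `66` is a standard supply element (`p = 11`, `d = 6`,
`(2, 6) = 2`, `6/2 = 3 > 2`). [cite: Aoki1987, §1 p. 387 (σ_{p,i}, d/(i,d) > 2)] -/
theorem sigma_eleven_two_mem :
    ({2, 8, 14, 20, 26, 32, 38, 44, 44, 50, 56, 62} : Multiset (ZMod 66)) ∈ Supply[66] :=
  Or.inr ⟨11, 2, by decide, by decide, by decide, by decide, by decide⟩

/-- `σ_{11,1} = {1, 7, …, 61} + {−11}` of level `66` is a standard supply element (`(1, 6) = 1`,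
`d = 6 > 2`: Aoki Thm 2-1 verbatim). [cite: Aoki1987, Thm. 2-1 (p. 388)] -/
theorem sigma_eleven_one_mem :
    ({1, 7, 13, 19, 25, 31, 37, 43, 49, 55, 55, 61} : Multiset (ZMod 66)) ∈ Supply[66] :=
  Or.inr ⟨11, 1, by decide, by decide, by decide, by decide, by decide⟩

/-- Every certificate shape is a supply element of level `66`. [folklore] -/
theorem mem_supply_of_certShape {u : Multiset (ZMod 66)} (h : CertShape[u]) : u ∈ Supply[66] := by
  rcases h with h | h | rfl | rfl
  · exact Or.inl (Or.inl (Or.inl h))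
  · exact Or.inl (Or.inl (Or.inr h))
  · exact sigma_eleven_two_mem
  · exact sigma_eleven_one_mem

set_option maxRecDepth 100000 in
/-- All 75 elements of `POS` have a certificate shape (59 pairs + 16 Hodge 4-multisets; Hodge-ness of
each 4-multiset decided over the 20 units of `ℤ/66`). [folklore] -/
theorem certShape_of_mem_POS : ∀ u ∈ POS, CertShape[u] := by
  decide +kernel

set_option maxRecDepth 100000 in
/-- All 40 elements of `NEG` have a certificate shape. [folklore] -/
theorem certShape_of_mem_NEG : ∀ u ∈ NEG, CertShape[u] := by
  decide +kernel

/-- **The level-66 certificate**: `2 •` da Silva's class is ℤ-reachable from the printed supply of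
level `66` (`P = POS`, `N = NEG`). Kernel-checked; replaces the four Python verifications
(`cert66.py`, `cert66_check.py`, `gaplattice.py`, `cert66_mine.py`). [folklore] -/
theorem reach_sixtySix_daSilvaDouble :
    Reach[2 * 33, LevelRaise[2, 33, ({7, 10, 13, 19, 22, 28} : Multiset (ZMod 33))]] :=
  ⟨POS, NEG, fun u hu ↦ mem_supply_of_certShape (certShape_of_mem_POS u hu),
    fun u hu ↦ mem_supply_of_certShape (certShape_of_mem_NEG u hu), identity_sixtySix⟩

/-- **da Silva's non-quasi-decomposable class of `X⁴₃₃` is stably reachable** (`k = 2`): the one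
obstruction to Shioda's programme in degree `33` (da Silva 2021 Prop. 3.6 / version of record
Prop. 3.4; the class of `DerivedTorelliFermat.Fermat33AccidentalClass`) is NOT a residual class of
this line — it needs no engine (S4), only S1–S3b. The level change is NECESSARY: at level `33` alone
the printed calculus cannot reach it (Disproof §7 `exists_levelCalculusClosed_not_daSilva33`).
[cite: daSilva2021HodgeFermat, Prop. 3.6] -/
theorem stableReach_daSilvaGap :
    StableReach[33, ({7, 10, 13, 19, 22, 28} : Multiset (ZMod 33))] :=
  ⟨2, Nat.two_pos, reach_sixtySix_daSilvaDouble⟩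

/-! ### Glue proved here: claim of every Hodge character from the stubs, one degree at a time -/

/-- **Claim for a stably reachable non-empty Hodge multiset** from S1, S2, S3a, S3b and the named facts
of S0: raise the level (S2: `k • s` is Hodge), feed the supply of level `km` (S3b, itself fed S3a and
S2) to the lattice criterion (S1), descend (S2). [folklore assembly] -/
theorem claimMultiset_of_stableReach {m : ℕ} [NeZero m]
    (hJ : Aoki1987_claim_juxtaposition) (hC : Aoki1987_claim_of_claim_juxtaposition_paired)
    (hP : Shioda_claim_paired) (hNS : AokiShioda1983_eigenline_le_neronSeveri) (hS : Aoki1987_claim_pStandard)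
    (h1 : Aoki1987_claim_juxtaposition → Aoki1987_claim_of_claim_juxtaposition_paired →
      ∀ (M : ℕ) [NeZero M] (D : Set (Multiset (ZMod M))),
        (∀ u ∈ D, u ≠ 0 ∧ IsHodgeMultiset u ∧ ClaimMultiset M u ∧
          ClaimMultiset M (u.map fun a ↦ -a)) →
        ∀ (s : Multiset (ZMod M)) (P N : Multiset (Multiset (ZMod M))),
          s ≠ 0 → IsHodgeMultiset s → (∀ u ∈ P, u ∈ D) → (∀ u ∈ N, u ∈ D) → s + N.sum = P.sum →
          ClaimMultiset M s)
    (h2 : ∀ (m k : ℕ) [NeZero m], 0 < k → ∀ s : Multiset (ZMod m), s ≠ 0 → IsHodgeMultiset s →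
      IsHodgeMultiset (LevelRaise[k, m, s]) ∧ (ClaimMultiset m s ↔ ClaimMultiset (k * m) (LevelRaise[k, m, s])))
    (h3a : ∀ (M : ℕ) [NeZero M] (s : Multiset (ZMod M)), IsHodgeMultiset s → IsSemiDecomposable s →
      ClaimMultiset M s)
    (h3 : Shioda_claim_paired → AokiShioda1983_eigenline_le_neronSeveri → Aoki1987_claim_pStandard →
      (∀ (M : ℕ) [NeZero M] (s : Multiset (ZMod M)), IsHodgeMultiset s → IsSemiDecomposable s →
        ClaimMultiset M s) →
      (∀ (m k : ℕ) [NeZero m], 0 < k → ∀ s : Multiset (ZMod m), s ≠ 0 → IsHodgeMultiset s →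
        IsHodgeMultiset (LevelRaise[k, m, s]) ∧
          (ClaimMultiset m s ↔ ClaimMultiset (k * m) (LevelRaise[k, m, s]))) →
      ∀ (M : ℕ) [NeZero M], ∀ u ∈ Supply[M],
        u ≠ 0 ∧ IsHodgeMultiset u ∧ ClaimMultiset M u ∧ ClaimMultiset M (u.map fun a ↦ -a))
    {s : Multiset (ZMod m)} (hs0 : s ≠ 0) (hs : IsHodgeMultiset s) (hR : StableReach[m, s]) :
    ClaimMultiset m s := by
  obtain ⟨k, hk, P, N, hPs, hNs, hEq⟩ := hR
  haveI : NeZero (k * m) := ⟨Nat.mul_ne_zero hk.ne' (NeZero.ne m)⟩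
  obtain ⟨hsk, hiff⟩ := h2 m k hk s hs0 hs
  have hsk0 : LevelRaise[k, m, s] ≠ 0 := fun h ↦ hs0 (Multiset.map_eq_zero.1 h)
  exact hiff.2 (h1 hJ hC (k * m) (Supply[k * m]) (h3 hP hNS hS h3a h2 (k * m)) _ P N hsk0 hsk hPs hNs hEq)

/-- **Claim for every non-empty Hodge multiset of level `m ≥ 1`** from S1–S4 and the named facts of
S0: the stably reachable ones by `claimMultiset_of_stableReach`, the residual ones by the engine (S4).
[folklore assembly] -/
theorem claimMultiset_of_stubs {m : ℕ} [NeZero m]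
    (hJ : Aoki1987_claim_juxtaposition) (hC : Aoki1987_claim_of_claim_juxtaposition_paired)
    (hP : Shioda_claim_paired) (hNS : AokiShioda1983_eigenline_le_neronSeveri) (hS : Aoki1987_claim_pStandard)
    (h1 : Aoki1987_claim_juxtaposition → Aoki1987_claim_of_claim_juxtaposition_paired →
      ∀ (M : ℕ) [NeZero M] (D : Set (Multiset (ZMod M))),
        (∀ u ∈ D, u ≠ 0 ∧ IsHodgeMultiset u ∧ ClaimMultiset M u ∧
          ClaimMultiset M (u.map fun a ↦ -a)) →
        ∀ (s : Multiset (ZMod M)) (P N : Multiset (Multiset (ZMod M))),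
          s ≠ 0 → IsHodgeMultiset s → (∀ u ∈ P, u ∈ D) → (∀ u ∈ N, u ∈ D) → s + N.sum = P.sum →
          ClaimMultiset M s)
    (h2 : ∀ (m k : ℕ) [NeZero m], 0 < k → ∀ s : Multiset (ZMod m), s ≠ 0 → IsHodgeMultiset s →
      IsHodgeMultiset (LevelRaise[k, m, s]) ∧ (ClaimMultiset m s ↔ ClaimMultiset (k * m) (LevelRaise[k, m, s])))
    (h3a : ∀ (M : ℕ) [NeZero M] (s : Multiset (ZMod M)), IsHodgeMultiset s → IsSemiDecomposable s →
      ClaimMultiset M s)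
    (h3 : Shioda_claim_paired → AokiShioda1983_eigenline_le_neronSeveri → Aoki1987_claim_pStandard →
      (∀ (M : ℕ) [NeZero M] (s : Multiset (ZMod M)), IsHodgeMultiset s → IsSemiDecomposable s →
        ClaimMultiset M s) →
      (∀ (m k : ℕ) [NeZero m], 0 < k → ∀ s : Multiset (ZMod m), s ≠ 0 → IsHodgeMultiset s →
        IsHodgeMultiset (LevelRaise[k, m, s]) ∧
          (ClaimMultiset m s ↔ ClaimMultiset (k * m) (LevelRaise[k, m, s]))) →
      ∀ (M : ℕ) [NeZero M], ∀ u ∈ Supply[M],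
        u ≠ 0 ∧ IsHodgeMultiset u ∧ ClaimMultiset M u ∧ ClaimMultiset M (u.map fun a ↦ -a))
    (h4 : ∀ (m : ℕ) [NeZero m] (s : Multiset (ZMod m)), s ≠ 0 → IsHodgeMultiset s →
      ¬ StableReach[m, s] → ClaimMultiset m s)
    {s : Multiset (ZMod m)} (hs0 : s ≠ 0) (hs : IsHodgeMultiset s) : ClaimMultiset m s := by
  by_cases hR : StableReach[m, s]
  · exact claimMultiset_of_stableReach hJ hC hP hNS hS h1 h2 h3a h3 hs0 hs hR
  · exact h4 m s hs0 hs hR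

/-- **The degree-33 pay-off, engine-free**: granted the named facts of S0 and the statements of S1, S2,
S3a, S3b (all research risk nil), da Silva's class `(7,10,13,19,22,28)` — hence `claim` for its
eigenline `V(α) ⊂ H⁴(X⁴₃₃(ℂ); ℂ)` — is claimed: `α` is the character for which "nothing in print"
constructs a cycle (Disproof §5–§7). Sorry-free given the stub statements as hypotheses.
[folklore assembly] -/
theorem claimMultiset_daSilvaGap_of_stubs
    (hJ : Aoki1987_claim_juxtaposition) (hC : Aoki1987_claim_of_claim_juxtaposition_paired)
    (hP : Shioda_claim_paired) (hNS : AokiShioda1983_eigenline_le_neronSeveri) (hS : Aoki1987_claim_pStandard)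
    (h1 : Aoki1987_claim_juxtaposition → Aoki1987_claim_of_claim_juxtaposition_paired →
      ∀ (M : ℕ) [NeZero M] (D : Set (Multiset (ZMod M))),
        (∀ u ∈ D, u ≠ 0 ∧ IsHodgeMultiset u ∧ ClaimMultiset M u ∧
          ClaimMultiset M (u.map fun a ↦ -a)) →
        ∀ (s : Multiset (ZMod M)) (P N : Multiset (Multiset (ZMod M))),
          s ≠ 0 → IsHodgeMultiset s → (∀ u ∈ P, u ∈ D) → (∀ u ∈ N, u ∈ D) → s + N.sum = P.sum →
          ClaimMultiset M s)
    (h2 : ∀ (m k : ℕ) [NeZero m], 0 < k → ∀ s : Multiset (ZMod m), s ≠ 0 → IsHodgeMultiset s →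
      IsHodgeMultiset (LevelRaise[k, m, s]) ∧ (ClaimMultiset m s ↔ ClaimMultiset (k * m) (LevelRaise[k, m, s])))
    (h3a : ∀ (M : ℕ) [NeZero M] (s : Multiset (ZMod M)), IsHodgeMultiset s → IsSemiDecomposable s →
      ClaimMultiset M s)
    (h3 : Shioda_claim_paired → AokiShioda1983_eigenline_le_neronSeveri → Aoki1987_claim_pStandard →
      (∀ (M : ℕ) [NeZero M] (s : Multiset (ZMod M)), IsHodgeMultiset s → IsSemiDecomposable s →
        ClaimMultiset M s) →
      (∀ (m k : ℕ) [NeZero m], 0 < k → ∀ s : Multiset (ZMod m), s ≠ 0 → IsHodgeMultiset s →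
        IsHodgeMultiset (LevelRaise[k, m, s]) ∧
          (ClaimMultiset m s ↔ ClaimMultiset (k * m) (LevelRaise[k, m, s]))) →
      ∀ (M : ℕ) [NeZero M], ∀ u ∈ Supply[M],
        u ≠ 0 ∧ IsHodgeMultiset u ∧ ClaimMultiset M u ∧ ClaimMultiset M (u.map fun a ↦ -a)) :
    ClaimMultiset 33 ({7, 10, 13, 19, 22, 28} : Multiset (ZMod 33)) :=
  claimMultiset_of_stableReach hJ hC hP hNS hS h1 h2 h3a h3 (by decide)
    (by unfold IsHodgeMultiset mNormSum; decide) stableReach_daSilvaGap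

/-- **THE TRANSFER, kernel-checked: a SATURATED degree has HC in every dimension.** Granted the named
facts of S0 and the statements of S1, S2, S3a, S3b, S5 (all research risk nil): if every non-empty
Hodge multiset of level `m ≥ 1` is stably reachable from the printed supply (`C⁺(m)`, one finite
lattice statement per degree — by the census the case for 40 of the 71 tested degrees, among them
`33, 39, 66, 78, 99, 117` where no theorem is in print), then `HodgeConjectureFor n X` for EVERY
smooth projective Fermat variety `X` of degree `m` and every `n`. The engine S4 is not used. For
`m = 33` the remaining input `C⁺(33)` is the finite lattice certificate D33 of the line card (a
ℤ-basis of `L^ev₃₃ ⊂ ℤ³²`, rank 22, each basis vector a `Reach` identity at level `33` or `66`; the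
one non-`K₃₃` generator is `stableReach_daSilvaGap`). [folklore assembly] -/
theorem hodgeConjectureFor_of_saturated {m : ℕ} [NeZero m]
    (hJ : Aoki1987_claim_juxtaposition) (hC : Aoki1987_claim_of_claim_juxtaposition_paired)
    (hP : Shioda_claim_paired) (hNS : AokiShioda1983_eigenline_le_neronSeveri) (hS : Aoki1987_claim_pStandard)
    (hModel : ∀ (n : ℕ) (X : SchemeOver ℂ), nonempty_hodgeModel n X)
    (h1 : Aoki1987_claim_juxtaposition → Aoki1987_claim_of_claim_juxtaposition_paired →
      ∀ (M : ℕ) [NeZero M] (D : Set (Multiset (ZMod M))),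
        (∀ u ∈ D, u ≠ 0 ∧ IsHodgeMultiset u ∧ ClaimMultiset M u ∧
          ClaimMultiset M (u.map fun a ↦ -a)) →
        ∀ (s : Multiset (ZMod M)) (P N : Multiset (Multiset (ZMod M))),
          s ≠ 0 → IsHodgeMultiset s → (∀ u ∈ P, u ∈ D) → (∀ u ∈ N, u ∈ D) → s + N.sum = P.sum →
          ClaimMultiset M s)
    (h2 : ∀ (m k : ℕ) [NeZero m], 0 < k → ∀ s : Multiset (ZMod m), s ≠ 0 → IsHodgeMultiset s →
      IsHodgeMultiset (LevelRaise[k, m, s]) ∧ (ClaimMultiset m s ↔ ClaimMultiset (k * m) (LevelRaise[k, m, s])))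
    (h3a : ∀ (M : ℕ) [NeZero M] (s : Multiset (ZMod M)), IsHodgeMultiset s → IsSemiDecomposable s →
      ClaimMultiset M s)
    (h3 : Shioda_claim_paired → AokiShioda1983_eigenline_le_neronSeveri → Aoki1987_claim_pStandard →
      (∀ (M : ℕ) [NeZero M] (s : Multiset (ZMod M)), IsHodgeMultiset s → IsSemiDecomposable s →
        ClaimMultiset M s) →
      (∀ (m k : ℕ) [NeZero m], 0 < k → ∀ s : Multiset (ZMod m), s ≠ 0 → IsHodgeMultiset s →
        IsHodgeMultiset (LevelRaise[k, m, s]) ∧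
          (ClaimMultiset m s ↔ ClaimMultiset (k * m) (LevelRaise[k, m, s]))) →
      ∀ (M : ℕ) [NeZero M], ∀ u ∈ Supply[M],
        u ≠ 0 ∧ IsHodgeMultiset u ∧ ClaimMultiset M u ∧ ClaimMultiset M (u.map fun a ↦ -a))
    (h5 : ∀ (m : ℕ) [NeZero m] ⦃p : ℕ⦄, 0 < p →
      (∀ α : Fin (2 * p + 2) → ZMod m, α ≠ 0 → (∃ i, α i = 0) → fermatEigenspace m α (2 * p) = ⊥) ∧
      (fermatEigenspace m (0 : Fin (2 * p + 2) → ZMod m) (2 * p) ≤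
        LinearMap.range (complexBetti.map (SmoothHypersurface.hypersurfaceι (fermatPolynomial ℂ (2 * p) m)) (2 * p)).hom) ∧
      (∀ (A : HodgeModel (2 * p) (fermatHypersurface (2 * p) m)) (β : Fin (2 * p + 2) → ZMod m),
        (∀ i, β i ≠ 0) →
        (∃ x ∈ fermatEigenspace m β (2 * p), x ≠ 0 ∧ A.pullback (2 * p) x ∈ A.hodgePQ (2 * p) p p) →
          2 * FermatCharacter.normSum β = m * (2 * p + 2)))
    (hSat : ∀ s : Multiset (ZMod m), s ≠ 0 → IsHodgeMultiset s → StableReach[m, s])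
    ⦃n : ℕ⦄ ⦃X : SchemeOver ℂ⦄ (hF : IsFermatVariety n m X) (hX : IsSmoothProjective n X) :
    HodgeConjectureFor n X := by
  refine ⟨hModel n X hX, fun p c hc hpp ↦ ?_⟩
  refine hodgeClasses_algebraic_fermat_of_claims_at' (m := m) (fun p hp ↦ h5 m hp) (fun p hp α hα ↦ ?_)
    hF hX p c hc hpp
  have hs : IsHodgeMultiset (univ.val.map α) := hα.isHodgeMultiset
  have hs0 : univ.val.map α ≠ 0 := by
    intro h0
    have hcard := congrArg Multiset.card h0
    rw [card_univ_val_map, Multiset.card_zero] at hcard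
    omega
  exact (claimMultiset_univ_val_map_iff α).1
    (claimMultiset_of_stableReach hJ hC hP hNS hS h1 h2 h3a h3 hs0 hs (hSat _ hs0 hs))

/-! ### The composition: the seven stubs imply the crux, by name -/

/-- `LineImplication` — THE SHAPE OF THE LINE as one proposition: S0 → S1 → S2 → S3a → S3b → S4 → S5 →
`HodgeFermatVarieties`, the statements of the seven stubs spelled out verbatim (so that
`lineImplication` is a sorry-free, kernel-checked certificate that the registered stub STATEMENTS
compose into the crux, and `HodgeFermatVarieties_of` is literally
`lineImplication stub_printedFacts … stub_eigenspaceStructure`). -/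
abbrev LineImplication : Prop :=
    (Aoki1987_claim_juxtaposition ∧ Aoki1987_claim_of_claim_juxtaposition_paired ∧
      Shioda_claim_paired ∧ Aoki1987_claim_pStandard ∧ AokiShioda1983_eigenline_le_neronSeveri ∧
      ∀ (n : ℕ) (X : SchemeOver ℂ), nonempty_hodgeModel n X) →
    (Aoki1987_claim_juxtaposition → Aoki1987_claim_of_claim_juxtaposition_paired →
      ∀ (M : ℕ) [NeZero M] (D : Set (Multiset (ZMod M))),
        (∀ u ∈ D, u ≠ 0 ∧ IsHodgeMultiset u ∧ ClaimMultiset M u ∧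
          ClaimMultiset M (u.map fun a ↦ -a)) →
        ∀ (s : Multiset (ZMod M)) (P N : Multiset (Multiset (ZMod M))),
          s ≠ 0 → IsHodgeMultiset s → (∀ u ∈ P, u ∈ D) → (∀ u ∈ N, u ∈ D) → s + N.sum = P.sum →
          ClaimMultiset M s) →
    (∀ (m k : ℕ) [NeZero m], 0 < k → ∀ s : Multiset (ZMod m), s ≠ 0 → IsHodgeMultiset s →
      IsHodgeMultiset (LevelRaise[k, m, s]) ∧ (ClaimMultiset m s ↔ ClaimMultiset (k * m) (LevelRaise[k, m, s]))) →
    (∀ (M : ℕ) [NeZero M] (s : Multiset (ZMod M)), IsHodgeMultiset s → IsSemiDecomposable s →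
      ClaimMultiset M s) →
    (Shioda_claim_paired → AokiShioda1983_eigenline_le_neronSeveri → Aoki1987_claim_pStandard →
      (∀ (M : ℕ) [NeZero M] (s : Multiset (ZMod M)), IsHodgeMultiset s → IsSemiDecomposable s →
        ClaimMultiset M s) →
      (∀ (m k : ℕ) [NeZero m], 0 < k → ∀ s : Multiset (ZMod m), s ≠ 0 → IsHodgeMultiset s →
        IsHodgeMultiset (LevelRaise[k, m, s]) ∧
          (ClaimMultiset m s ↔ ClaimMultiset (k * m) (LevelRaise[k, m, s]))) →
      ∀ (M : ℕ) [NeZero M], ∀ u ∈ Supply[M],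
        u ≠ 0 ∧ IsHodgeMultiset u ∧ ClaimMultiset M u ∧ ClaimMultiset M (u.map fun a ↦ -a)) →
    (∀ (m : ℕ) [NeZero m] (s : Multiset (ZMod m)), s ≠ 0 → IsHodgeMultiset s →
      ¬ StableReach[m, s] → ClaimMultiset m s) →
    (∀ (m : ℕ) [NeZero m] ⦃p : ℕ⦄, 0 < p →
      (∀ α : Fin (2 * p + 2) → ZMod m, α ≠ 0 → (∃ i, α i = 0) → fermatEigenspace m α (2 * p) = ⊥) ∧
      (fermatEigenspace m (0 : Fin (2 * p + 2) → ZMod m) (2 * p) ≤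
        LinearMap.range (complexBetti.map (SmoothHypersurface.hypersurfaceι (fermatPolynomial ℂ (2 * p) m)) (2 * p)).hom) ∧
      (∀ (A : HodgeModel (2 * p) (fermatHypersurface (2 * p) m)) (β : Fin (2 * p + 2) → ZMod m),
        (∀ i, β i ≠ 0) →
        (∃ x ∈ fermatEigenspace m β (2 * p), x ≠ 0 ∧ A.pullback (2 * p) x ∈ A.hodgePQ (2 * p) p p) →
          2 * FermatCharacter.normSum β = m * (2 * p + 2))) →
    Summit.HodgeConjecture.HodgeConjecture.Theses.PadicSemiregularLift.HodgeFermatVarieties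

/-- **The seven stub statements imply the crux** (sorry-free). `m = 0` is vacuous
(landed `HodgeFermatVarietiesNegative.degree_zero_vacuous`); for `m ≥ 1` the Hodge model comes from
S0's `nonempty_hodgeModel`, and the cycle part from the tree's per-degree assembly
`hodgeClasses_algebraic_fermat_of_claims_at'` (Lefschetz off the middle degree is DISCHARGED in the
tree; transport to the standard model is proved there) fed the eigenspace structure S5 and claim for
every Hodge character (`claimMultiset_of_stubs` + `claimMultiset_univ_val_map_iff`). [folklore assembly] -/
theorem lineImplication : LineImplication := by
  intro h0 h1 h2 h3a h3 h4 h5 n m X hF hX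
  obtain ⟨hJ, hC, hP, hS, hNS, hModel⟩ := h0
  rcases Nat.eq_zero_or_pos m with rfl | hm
  · exact (Summit.HodgeConjecture.HodgeConjecture.Theorems.HodgeFermatVarietiesNegative.degree_zero_vacuous hF hX).elim
  haveI : NeZero m := ⟨by omega⟩
  refine ⟨hModel n X hX, fun p c hc hpp ↦ ?_⟩
  refine hodgeClasses_algebraic_fermat_of_claims_at' (m := m) (fun p hp ↦ h5 m hp) (fun p hp α hα ↦ ?_)
    hF hX p c hc hpp
  have hs : IsHodgeMultiset (univ.val.map α) := hα.isHodgeMultiset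
  have hs0 : univ.val.map α ≠ 0 := by
    intro h0
    have hcard := congrArg Multiset.card h0
    rw [card_univ_val_map, Multiset.card_zero] at hcard
    omega
  exact (claimMultiset_univ_val_map_iff α).1
    (claimMultiset_of_stubs hJ hC hP hNS hS h1 h2 h3a h3 h4 hs0 hs)

/-- **`HodgeFermatVarieties_of` — the crux BY NAME from the seven registered stubs** (kernel-checked;
the only `sorry`s of the file live inside `stub_*`, which enter here by name through
`lineImplication`). -/
theorem HodgeFermatVarieties_of :
    Summit.HodgeConjecture.HodgeConjecture.Theses.PadicSemiregularLift.HodgeFermatVarieties :=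
  lineImplication stub_printedFacts stub_latticeCriterion stub_levelChange stub_semiDecomposableClaim
    stub_printedSupply stub_residualSignClasses stub_eigenspaceStructure

end Summit.HodgeConjecture.HodgeConjecture.Cruxes.HodgeFermatVarieties.CancelByAnyClaimLattice

end
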